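import Literature.AlgebraicGeometry.Motives.HirschowitzIyerCoveringValuative
import Literature.AlgebraicGeometry.Motives.HirschowitzIyerSurjectivity
import Literature.AlgebraicGeometry.Motives.CompleteIntersectionLinesThroughPoints
import HarnessLib

/-!
# Strong lines cover a `(2,3)` complete intersection in `ℙ⁸` (Hirschowitz–Iyer 2010, Prop. 6.1)

Hirschowitz–Iyer, *Hilbert schemes of fat r-planes and the triviality of Chow groups of complete
intersections* [HirschowitzIyer2010], §6 Prop. 6.1 ("spannedness") for `(n, r, s, d) = (8, 1, 2, (2, 3))`
(`ρ + r = 6 = n - s`, the boundary of HI's range): **for a quadric `Q` and a cubic `C` on `ℙ⁸` over an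
algebraically closed field of characteristic zero, through every closed point of `Y = V₊(Q, C)` passes a
strong line of the pair `Y ⊂ Y' = V₊(Q)`** — `exists_isStrongLinePoint_of_isClosed`, in the vocabulary
`IsStrongLinePoint Q C 1 v` of `Motives/HirschowitzIyerSurjectivity` (a line of `Y` lying in a `2`-plane
`Π ⊆ V₊(Q)` with `Π ∩ V₊(C) = Π ∩ V₊(ℓ)` for a linear form `ℓ ∉ 𝔭_Π`, or `Π ⊆ V₊(C)`). This is the
covering hypothesis of HI's surjectivity theorem §1.4/§2 for that pair. No smoothness is needed.

The proof is the coordinate theorem of `Motives/HirschowitzIyerCoveringAlgebra` +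
`Motives/HirschowitzIyerCoveringValuative` (`StrongLineCover.exists_fatFlag_of_incidence`: the universal
strong-line family dominates the incidence, by an explicit rigid example and the fibre-dimension
inequality, and every point of the incidence is reached, by the valuative criterion in coordinates and
the Nullstellensatz), dressed up:

* `StrongLineCover.tensor2`, `tensor3`, `bilin_tensor2`, `trilin_tensor3` — a quadratic / cubic form
  as a bilinear / trilinear tensor (one entry per monomial; `Q(q) = Σ B_{ij} q_i q_j`);
* `StrongLineCover.IsFatFlag.reindex`, `bilin_reindex`, … — transport along a permutation of the
  coordinates and scalings; `StrongLineCover.exists_fatFlag_of_forms` — **for forms `Q, C` and ANY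
  non-zero `p` with `Q(p) = C(p) = 0` there are independent `u, v, w` with `p ∈ span(u, v)`, `Q ≡ 0`
  on `span(u, v, w)` and `C(c₀u + c₁v + c₂w) = c₂³ C(w)`** (normalise `p_{c₀} = 1`, swap `0 ↔ c₀`);
* `exists_isStrongLinePoint_of_isClosed` — the scheme statement, assembled exactly as the lines /
  planes through closed points of `Motives/CompleteIntersectionLinesThroughPoints`
  (`EsnaultLevineViehweg.exists_algPoints_pt_eq`, `ProjectiveSpace.exists_eq_pointOfVec`,
  `exists_linearForms_forall_mem_ideal_span`, `exists_isLinearSubspacePoint_of_zeroLocus_subset`): the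
  linear form `ℓ` with `ℓ(u) = ℓ(v) = 0`, `ℓ(w) = 1` is a coordinate form of a basis extending
  `(u, v, w)`; the plane `Π = V₊(M₁, …, M₆)` is cut out with `Q, C - C(w) ℓ³ ∈ (M)`, the line
  `L = V₊(L₁, …, L₇)` with `M_j, Q, C, ℓ ∈ (L)`; hence `L ⊆ Π ⊆ V₊(Q)`, `L ⊆ V₊(Q, C)`, and on `Π` one
  has `C ≡ C(w) ℓ³`, so `Π ∩ V₊(C) = Π ∩ V₊(ℓ)` when `C(w) ≠ 0` (`ℓ ∉ 𝔭_Π` as `ℓ(w) = 1` while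
  `𝔭_Π = (M)` vanishes at `w`, `toIdeal_linearSubspacePoint`) and `Π ⊆ V₊(C)` when `C(w) = 0`.

## References

* A. Hirschowitz, J. N. N. Iyer, *Hilbert schemes of fat r-planes and the triviality of Chow groups
  of complete intersections*, Contemp. Math. 522 (2010), doi:10.1090/conm/522/10291,
  arXiv:0903.5018: §1.2, §1.5, §2 Prop. 2.3, §6 Prop. 6.1. [HirschowitzIyer2010]
* R. Hartshorne, *Algebraic Geometry* (1977), I Ex. 2.11 (linear varieties). [Hartshorne1977]
-/

noncomputable section

open MvPolynomial Matrix

universe u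

namespace Literature.AlgebraicGeometry.Motives

namespace StrongLineCover

/-! ### Tensorisation of quadratic and cubic forms -/

section Tensor

variable {K : Type*} [Field K]

/-- A monomial of degree `2` is `x_i x_j`. [folklore] -/
theorem exists_eq_single_add_single {σ : Type*} (m : σ →₀ ℕ) (h : m.degree = 2) :
    ∃ ij : σ × σ, m = Finsupp.single ij.1 1 + Finsupp.single ij.2 1 := by
  classical
  have hc : Multiset.card (Finsupp.toMultiset m) = 2 := by
    rw [Finsupp.card_toMultiset, ← h, Finsupp.degree_apply]; rfl
  obtain ⟨i, j, hij⟩ := Multiset.card_eq_two.1 hc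
  refine ⟨(i, j), ?_⟩
  calc m = (Finsupp.toMultiset m).toFinsupp := by simp
    _ = Finsupp.single i 1 + Finsupp.single j 1 := by
      rw [hij, Multiset.insert_eq_cons, ← Multiset.singleton_add, map_add, Multiset.toFinsupp_singleton,
        Multiset.toFinsupp_singleton]

/-- A monomial of degree `3` is `x_i x_j x_l`. [folklore] -/
theorem exists_eq_single_add_single_add_single {σ : Type*} (m : σ →₀ ℕ) (h : m.degree = 3) :
    ∃ p : σ × σ × σ, m = Finsupp.single p.1 1 + Finsupp.single p.2.1 1 + Finsupp.single p.2.2 1 := by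
  classical
  have hc : Multiset.card (Finsupp.toMultiset m) = 3 := by
    rw [Finsupp.card_toMultiset, ← h, Finsupp.degree_apply]; rfl
  obtain ⟨i, j, l, hijl⟩ := Multiset.card_eq_three.1 hc
  refine ⟨(i, j, l), ?_⟩
  calc m = (Finsupp.toMultiset m).toFinsupp := by simp
    _ = Finsupp.single i 1 + Finsupp.single j 1 + Finsupp.single l 1 := by
      rw [hijl, Multiset.insert_eq_cons, Multiset.insert_eq_cons, ← Multiset.singleton_add,
        ← Multiset.singleton_add, map_add, map_add, Multiset.toFinsupp_singleton,
        Multiset.toFinsupp_singleton, Multiset.toFinsupp_singleton, add_assoc]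

/-- A chosen pair `(i, j)` with `m = x_i x_j` for a degree-`2` monomial `m` (junk otherwise). [folklore] -/
def pairOf {σ : Type*} [Inhabited σ] (m : σ →₀ ℕ) : σ × σ :=
  if h : m.degree = 2 then (exists_eq_single_add_single m h).choose else default

/-- Specification of `pairOf`. [folklore] -/
theorem pairOf_spec {σ : Type*} [Inhabited σ] (m : σ →₀ ℕ) (h : m.degree = 2) :
    m = Finsupp.single (pairOf m).1 1 + Finsupp.single (pairOf m).2 1 := by
  rw [pairOf, dif_pos h]
  exact (exists_eq_single_add_single m h).choose_spec

/-- A chosen triple `(i, j, l)` with `m = x_i x_j x_l` for a degree-`3` monomial (junk otherwise). [folklore] -/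
def tripleOf {σ : Type*} [Inhabited σ] (m : σ →₀ ℕ) : σ × σ × σ :=
  if h : m.degree = 3 then (exists_eq_single_add_single_add_single m h).choose else default

/-- Specification of `tripleOf`. [folklore] -/
theorem tripleOf_spec {σ : Type*} [Inhabited σ] (m : σ →₀ ℕ) (h : m.degree = 3) :
    m = Finsupp.single (tripleOf m).1 1 + Finsupp.single (tripleOf m).2.1 1 + Finsupp.single (tripleOf m).2.2 1 := by
  rw [tripleOf, dif_pos h]
  exact (exists_eq_single_add_single_add_single m h).choose_spec

/-- **The bilinear tensor of a quadratic form**: one entry per monomial of `Q`. [folklore] -/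
def tensor2 (Q : MvPolynomial (Fin 9) K) : Fin 9 → Fin 9 → K := fun i j =>
  ∑ m ∈ Q.support, if pairOf m = (i, j) then coeff m Q else 0

/-- **The trilinear tensor of a cubic form**: one entry per monomial of `C`. [folklore] -/
def tensor3 (C : MvPolynomial (Fin 9) K) : Fin 9 × Fin 9 × Fin 9 → K := fun p =>
  ∑ m ∈ C.support, if tripleOf m = p then coeff m C else 0

/-- `x_i x_j` evaluates to `q_i q_j`. [folklore] -/
theorem prod_single_add_single (q : Fin 9 → K) (i j : Fin 9) :
    (Finsupp.single i 1 + Finsupp.single j 1).prod (fun k e => q k ^ e) = q i * q j := by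
  classical
  rw [Finsupp.prod_add_index' (h := fun k e => q k ^ e) (fun _ => pow_zero _) (fun _ _ _ => pow_add _ _ _),
    Finsupp.prod_single_index (h := fun k e => q k ^ e) (pow_zero _),
    Finsupp.prod_single_index (h := fun k e => q k ^ e) (pow_zero _), pow_one, pow_one]

/-- `x_i x_j x_l` evaluates to `q_i q_j q_l`. [folklore] -/
theorem prod_single_add_single_add_single (q : Fin 9 → K) (i j l : Fin 9) :
    (Finsupp.single i 1 + Finsupp.single j 1 + Finsupp.single l 1).prod (fun k e => q k ^ e) = q i * q j * q l := by
  classical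
  rw [Finsupp.prod_add_index' (h := fun k e => q k ^ e) (fun _ => pow_zero _) (fun _ _ _ => pow_add _ _ _),
    prod_single_add_single, Finsupp.prod_single_index (h := fun k e => q k ^ e) (pow_zero _), pow_one]

/-- **`Q(q) = Σ B_{ij} q_i q_j`** for the tensor `B = tensor2 Q` of a quadratic form. [folklore] -/
theorem bilin_tensor2 {Q : MvPolynomial (Fin 9) K} (hQ : Q.IsHomogeneous 2) (q : Fin 9 → K) :
    bilin (tensor2 Q) q q = MvPolynomial.eval q Q := by
  classical
  have hinner : ∀ m : Fin 9 →₀ ℕ, (∑ i : Fin 9, ∑ j : Fin 9, (if pairOf m = (i, j) then coeff m Q else 0) * q i * q j) =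
      coeff m Q * q (pairOf m).1 * q (pairOf m).2 := by
    intro m
    rw [← Fintype.sum_prod_type' (f := fun i j => (if pairOf m = (i, j) then coeff m Q else 0) * q i * q j)]
    rw [Finset.sum_eq_single (pairOf m)]
    · simp
    · intro x _ hx
      rw [if_neg (fun h => hx (by rw [h])), zero_mul, zero_mul]
    · intro h; exact absurd (Finset.mem_univ _) h
  have h1 : bilin (tensor2 Q) q q = ∑ m ∈ Q.support, coeff m Q * q (pairOf m).1 * q (pairOf m).2 := by
    simp only [bilin, tensor2, Finset.sum_mul]
    conv_lhs => arg 2; ext i; rw [Finset.sum_comm]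
    rw [Finset.sum_comm]
    exact Finset.sum_congr rfl fun m _ => hinner m
  rw [h1]
  conv_rhs => rw [Q.as_sum, map_sum]
  refine Finset.sum_congr rfl fun m hm => ?_
  rw [eval_monomial]
  have hdeg : m.degree = 2 := by
    by_contra hne
    exact (mem_support_iff.1 hm) (hQ.coeff_eq_zero hne)
  have hp : m.prod (fun n e => q n ^ e) = q (pairOf m).1 * q (pairOf m).2 := by
    conv_lhs => rw [pairOf_spec m hdeg]
    exact prod_single_add_single q _ _
  rw [hp]; ring

/-- **`C(q) = Σ T_{ijl} q_i q_j q_l`** for the tensor `T = tensor3 C` of a cubic form. [folklore] -/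
theorem trilin_tensor3 {C : MvPolynomial (Fin 9) K} (hC : C.IsHomogeneous 3) (q : Fin 9 → K) :
    trilin (tensor3 C) q = MvPolynomial.eval q C := by
  classical
  have h1 : trilin (tensor3 C) q = ∑ m ∈ C.support, coeff m C * q (tripleOf m).1 * q (tripleOf m).2.1 * q (tripleOf m).2.2 := by
    simp only [trilin, tensor3, Finset.sum_mul]
    rw [Finset.sum_comm]
    refine Finset.sum_congr rfl fun m _ => ?_
    simp_rw [ite_mul, zero_mul]
    rw [Finset.sum_ite_eq]
    simp
  rw [h1]
  conv_rhs => rw [C.as_sum, map_sum]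
  refine Finset.sum_congr rfl fun m hm => ?_
  rw [eval_monomial]
  have hdeg : m.degree = 3 := by
    by_contra hne
    exact (mem_support_iff.1 hm) (hC.coeff_eq_zero hne)
  have hp : m.prod (fun n e => q n ^ e) = q (tripleOf m).1 * q (tripleOf m).2.1 * q (tripleOf m).2.2 := by
    conv_lhs => rw [tripleOf_spec m hdeg]
    exact prod_single_add_single_add_single q _ _ _
  rw [hp]; ring

end Tensor


/-! ### Transport of fat flags along coordinate permutations and scalings -/

section Transport

variable {K : Type*} [Field K]

/-- `comb` commutes with composition by a permutation of the coordinates. [folklore] -/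
theorem comb_comp (σ : Fin 9 ≃ Fin 9) (u v w : Fin 9 → K) (c : Fin 3 → K) :
    comb (u ∘ σ) (v ∘ σ) (w ∘ σ) c = comb u v w c ∘ σ := by
  ext i; simp [comb]

/-- Reindexing a bilinear form. [folklore] -/
theorem bilin_reindex (σ : Fin 9 ≃ Fin 9) (B : Fin 9 → Fin 9 → K) (q q' : Fin 9 → K) :
    bilin (fun i j => B (σ i) (σ j)) q q' = bilin B (q ∘ σ.symm) (q' ∘ σ.symm) := by
  simp only [bilin, Function.comp_apply]
  conv_rhs => rw [← Equiv.sum_comp σ]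
  refine Finset.sum_congr rfl fun i _ => ?_
  conv_rhs => rw [← Equiv.sum_comp σ]
  refine Finset.sum_congr rfl fun j _ => ?_
  simp

/-- Reindexing a trilinear form. [folklore] -/
theorem trilin_reindex (σ : Fin 9 ≃ Fin 9) (T : Fin 9 × Fin 9 × Fin 9 → K) (q : Fin 9 → K) :
    trilin (fun p => T (σ p.1, σ p.2.1, σ p.2.2)) q = trilin T (q ∘ σ.symm) := by
  simp only [trilin, Function.comp_apply]
  conv_rhs => rw [← Equiv.sum_comp (Equiv.prodCongr σ (Equiv.prodCongr σ σ))]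
  refine Finset.sum_congr rfl fun p _ => ?_
  obtain ⟨a, b, c⟩ := p
  simp

/-- **Fat flags transported along a permutation of the coordinates.** [folklore] -/
theorem IsFatFlag.reindex (σ : Fin 9 ≃ Fin 9) {B : Fin 9 → Fin 9 → K} {T : Fin 9 × Fin 9 × Fin 9 → K}
    {u v w : Fin 9 → K} (h : IsFatFlag (fun i j => B (σ i) (σ j)) (fun p => T (σ p.1, σ p.2.1, σ p.2.2)) u v w) :
    IsFatFlag B T (u ∘ σ.symm) (v ∘ σ.symm) (w ∘ σ.symm) := by
  refine ⟨fun c => ?_, fun c => ?_⟩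
  · have e := h.1 c
    rwa [bilin_reindex, ← comb_comp] at e
  · have e := h.2 c
    rw [trilin_reindex, trilin_reindex, ← comb_comp] at e
    exact e

/-- Scaling the arguments of a bilinear form. [folklore] -/
theorem bilin_smul (B : Fin 9 → Fin 9 → K) (a b : K) (q q' : Fin 9 → K) :
    bilin B (a • q) (b • q') = a * b * bilin B q q' := by
  simp only [bilin, Pi.smul_apply, smul_eq_mul, Finset.mul_sum]
  refine Finset.sum_congr rfl fun i _ => Finset.sum_congr rfl fun j _ => ?_
  ring

/-- Scaling the argument of a cubic form. [folklore] -/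
theorem trilin_smul (T : Fin 9 × Fin 9 × Fin 9 → K) (a : K) (q : Fin 9 → K) :
    trilin T (a • q) = a ^ 3 * trilin T q := by
  simp only [trilin, Pi.smul_apply, smul_eq_mul, Finset.mul_sum]
  refine Finset.sum_congr rfl fun p _ => ?_
  ring

/-- Linear independence of a triple is invariant under a permutation of the coordinates. [folklore] -/
theorem linearIndependent_comp_equiv (σ : Fin 9 ≃ Fin 9) {u v w : Fin 9 → K}
    (h : LinearIndependent K ![u, v, w]) : LinearIndependent K ![u ∘ σ, v ∘ σ, w ∘ σ] := by
  have heq : (![u ∘ σ, v ∘ σ, w ∘ σ] : Fin 3 → Fin 9 → K) =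
      (LinearEquiv.funCongrLeft K K σ : (Fin 9 → K) →ₗ[K] (Fin 9 → K)) ∘ ![u, v, w] := by
    funext i; fin_cases i <;> rfl
  rw [heq]
  exact h.map' _ (LinearEquiv.ker _)

/-- **The covering theorem in coordinates, for forms and an arbitrary point**: for a quadric `Q` and
a cubic `C` on `K⁹` (`K` algebraically closed of characteristic zero) and a non-zero vector `p` with
`Q(p) = C(p) = 0`, there are linearly independent `u, v, w` with `p ∈ span(u, v)`, `Q ≡ 0` on
`span(u, v, w)` and `C(c₀u + c₁v + c₂w) = c₂³ C(w)` — a strong line `ℙ(span(u, v)) ∋ [p]` of the pair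
`V(Q, C) ⊂ V(Q)` with witness plane `ℙ(span(u, v, w))`. (Rescale `p` and permute coordinates to
`p₀ = 1`, tensorise, apply `exists_fatFlag_of_incidence`, transport back.)
[cite: HirschowitzIyer2010, §6 Prop. 6.1] -/
theorem exists_fatFlag_of_forms [IsAlgClosed K] [CharZero K] {Q C : MvPolynomial (Fin 9) K}
    (hQ : Q.IsHomogeneous 2) (hC : C.IsHomogeneous 3) {p : Fin 9 → K} (hp : p ≠ 0)
    (hQp : MvPolynomial.eval p Q = 0) (hCp : MvPolynomial.eval p C = 0) :
    ∃ u v w : Fin 9 → K, LinearIndependent K ![u, v, w] ∧ p ∈ Submodule.span K {u, v} ∧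
      (∀ c : Fin 3 → K, MvPolynomial.eval (comb u v w c) Q = 0) ∧
      ∀ c : Fin 3 → K, MvPolynomial.eval (comb u v w c) C = c 2 ^ 3 * MvPolynomial.eval w C := by
  classical
  -- normalise `p` to `p₀ = 1` after a transposition of coordinates
  obtain ⟨c₀, hc₀⟩ := Function.ne_iff.mp hp
  set p₁ : Fin 9 → K := (p c₀)⁻¹ • p with hp₁
  set σ : Fin 9 ≃ Fin 9 := Equiv.swap 0 c₀ with hσ
  set p₂ : Fin 9 → K := p₁ ∘ σ with hp₂
  have hp₂0 : p₂ 0 = 1 := by simp [hp₂, hp₁, hσ, inv_mul_cancel₀ hc₀]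
  set B := tensor2 Q with hB
  set T := tensor3 C with hT
  set B₂ : Fin 9 → Fin 9 → K := fun i j => B (σ i) (σ j) with hB₂
  set T₂ : Fin 9 × Fin 9 × Fin 9 → K := fun q => T (σ q.1, σ q.2.1, σ q.2.2) with hT₂
  set t : NVar → K := fun n => match n with | .x i => p₂ i.succ | .b ij => B₂ ij.1 ij.2 | .t q => T₂ q with ht
  have hxt : xt t = p₂ := by
    funext i
    fin_cases i
    · simpa [xt, xN, ht] using hp₂0.symm
    all_goals simp [xt, xN, ht]
  have hp₂σ : p₂ ∘ σ.symm = p₁ := by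
    funext i; simp [hp₂]
  have hQBx : MvPolynomial.eval t QBx = 0 := by
    have h1 : MvPolynomial.eval t QBx = bilin B₂ (xt t) (xt t) := by
      simp [QBx, bilin, xt, ht, map_sum, map_mul]
    rw [h1, hxt, hB₂, bilin_reindex, hp₂σ, hp₁, bilin_smul, hB, bilin_tensor2 hQ, hQp, mul_zero]
  have hCTx : MvPolynomial.eval t CTx = 0 := by
    have h1 : MvPolynomial.eval t CTx = trilin T₂ (xt t) := by
      simp [CTx, trilin, xt, ht, map_sum, map_mul]
    rw [h1, hxt, hT₂, trilin_reindex, hp₂σ, hp₁, trilin_smul, hT, trilin_tensor3 hC, hCp, mul_zero]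
  obtain ⟨u₂, v₂, w₂, hli₂, ⟨α, β, hspan₂⟩, hfat₂⟩ := exists_fatFlag_of_incidence t hQBx hCTx
  -- transport back
  have hfat : IsFatFlag B T (u₂ ∘ σ.symm) (v₂ ∘ σ.symm) (w₂ ∘ σ.symm) := by
    refine IsFatFlag.reindex σ ?_
    exact hfat₂
  refine ⟨u₂ ∘ σ.symm, v₂ ∘ σ.symm, w₂ ∘ σ.symm, linearIndependent_comp_equiv σ.symm hli₂, ?_, ?_, ?_⟩
  · rw [Submodule.mem_span_pair]
    obtain ⟨γ, hγ⟩ : ∃ γ : K, γ = p c₀ := ⟨_, rfl⟩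
    refine ⟨γ * α, γ * β, ?_⟩
    have hp₁eq : p₁ = α • (u₂ ∘ σ.symm) + β • (v₂ ∘ σ.symm) := by
      rw [← hp₂σ, ← hxt, hspan₂]
      funext i; simp
    have hpeq : p = γ • p₁ := by
      rw [hp₁, smul_smul, hγ, mul_inv_cancel₀ hc₀, one_smul]
    rw [hpeq, hp₁eq, smul_add, smul_smul, smul_smul]
  · intro c
    rw [← bilin_tensor2 hQ]
    exact hfat.1 c
  · intro c
    rw [← trilin_tensor3 hC, ← trilin_tensor3 hC]
    exact hfat.2 c

end Transport

end StrongLineCover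

/-! ### Strong lines through every closed point of `V₊(Q, C) ⊂ ℙ⁸` -/

section Geometry

open _root_.CategoryTheory _root_.AlgebraicGeometry _root_.Order _root_.Topology _root_.TopologicalSpace StrongLineCover

variable {K : Type u} [Field K]

attribute [local instance] MvPolynomial.gradedAlgebra

/-- `V₊(Q, C) → Spec K` is locally of finite type. [folklore] -/
instance locallyOfFiniteType_quadricCubic_hom {n : ℕ} (Q C : MvPolynomial (Fin (n + 1)) K) :
    LocallyOfFiniteType (quadricCubic Q C).hom := by
  haveI : IsProper (projectiveSpace n K).hom := inferInstanceAs (IsProper ((ProjSpace.P n K) ↘ Spec (.of K)))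
  haveI : LocallyOfFiniteType (completeIntersectionι ![Q, C]).left := inferInstance
  change LocallyOfFiniteType ((completeIntersectionι ![Q, C]).left ≫ (projectiveSpace n K).hom)
  infer_instance

/-- A linear combination of three vectors is in their span (as the range of `![u, v, w]`). [folklore] -/
theorem comb_mem_span (u v w : Fin 9 → K) (c : Fin 3 → K) :
    comb u v w c ∈ Submodule.span K (Set.range ![u, v, w]) := by
  refine Submodule.add_mem _ (Submodule.add_mem _ ?_ ?_) ?_
  · exact Submodule.smul_mem _ _ (Submodule.subset_span ⟨0, rfl⟩)
  · exact Submodule.smul_mem _ _ (Submodule.subset_span ⟨1, rfl⟩)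
  · exact Submodule.smul_mem _ _ (Submodule.subset_span ⟨2, rfl⟩)

/-- Every vector of `span(u, v, w)` is a `comb`. [folklore] -/
theorem exists_comb_of_mem_span {u v w q : Fin 9 → K} (hq : q ∈ Submodule.span K (Set.range ![u, v, w])) :
    ∃ c : Fin 3 → K, q = comb u v w c := by
  obtain ⟨c, rfl⟩ := (Submodule.mem_span_range_iff_exists_fun K).1 hq
  exact ⟨c, by simp [comb, Fin.sum_univ_three]⟩

/-- Every vector of `span(u, v)` is a `comb` with last coefficient `0`. [folklore] -/
theorem exists_comb_of_mem_span_pair {u v w q : Fin 9 → K} (hq : q ∈ Submodule.span K (Set.range ![u, v])) :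
    ∃ c : Fin 3 → K, c 2 = 0 ∧ q = comb u v w c := by
  obtain ⟨c, rfl⟩ := (Submodule.mem_span_range_iff_exists_fun K).1 hq
  exact ⟨![c 0, c 1, 0], rfl, by simp [comb, Fin.sum_univ_two]⟩

/-- **Strong lines cover `Y = V₊(Q, C) ⊂ ℙ⁸`** (Hirschowitz–Iyer 2010, Prop. 6.1 "spannedness" for
`(n, r, s, d) = (8, 1, 2, (2, 3))`, where `ρ + r = 6 = n - s`): over an algebraically closed field of
characteristic zero, for a quadric `Q` and a cubic `C` on `ℙ⁸`, through every closed point `x` of the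
complete intersection `V₊(Q, C)` passes a STRONG LINE of the pair `V₊(Q, C) ⊂ V₊(Q)` — a line of
`V₊(Q, C)` (generic point `v`, `IsStrongLinePoint Q C 1 v`, `Motives/HirschowitzIyerSurjectivity`) lying
in a `2`-plane `Π ⊆ V₊(Q)` with `Π ∩ V₊(C) = Π ∩ V₊(ℓ)` set-theoretically for a linear form `ℓ ∉ 𝔭_Π`,
or `Π ⊆ V₊(C)`. Assembled from the coordinate theorem `StrongLineCover.exists_fatFlag_of_forms` (the
algebra + valuative files) exactly as lines/planes through points are transported in
`Motives/CompleteIntersectionLinesThroughPoints`. No smoothness of `V₊(Q, C)` is needed.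
[cite: HirschowitzIyer2010, §6 Prop. 6.1 (with §2 Prop. 2.3)] -/
theorem exists_isStrongLinePoint_of_isClosed [IsAlgClosed K] [CharZero K]
    {Q C : MvPolynomial (Fin (8 + 1)) K} (hQ : Q.IsHomogeneous 2) (hC : C.IsHomogeneous 3)
    {x : ↥(quadricCubic Q C).left} (hx : IsClosed ({x} : Set ↥(quadricCubic Q C).left)) :
    ∃ v : ↥(quadricCubic Q C).left, IsStrongLinePoint Q C 1 v ∧ x ∈ closure {v} := by
  classical
  set iY := completeIntersectionι ![Q, C] with hiY
  set iQ := completeIntersectionι (fun _ : Fin 1 => Q) with hiQ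
  -- homogeneous coordinates of `x`
  obtain ⟨P, hPx⟩ := EsnaultLevineViehweg.exists_algPoints_pt_eq (X := quadricCubic Q C) hx
  obtain ⟨p₀, hp₀, hP⟩ := ProjectiveSpace.exists_eq_pointOfVec (AlgPoints.map iY P)
  have hix : iY.left.base x = (ProjectiveSpace.pointOfVec K p₀ hp₀).pt := by
    rw [← hP, AlgPoints.pt_map, hPx]
  have hV : Set.range iY.left.base =
      ProjectiveSpectrum.zeroLocus (MvPolynomial.homogeneousSubmodule (Fin (8 + 1)) K) (Set.range ![Q, C]) :=
    range_completeIntersectionι _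
  have hmemV : (ProjectiveSpace.pointOfVec K p₀ hp₀).pt ∈
      ProjectiveSpectrum.zeroLocus (MvPolynomial.homogeneousSubmodule (Fin (8 + 1)) K) (Set.range ![Q, C]) := by
    rw [← hix, ← hV]; exact ⟨x, rfl⟩
  have hFp : ∀ j, MvPolynomial.eval p₀ (![Q, C] j) = 0 := by
    intro j
    have hdeg : 0 < (![2, 3] : Fin 2 → ℕ) j := by fin_cases j <;> norm_num
    have hhom : (![Q, C] j).IsHomogeneous ((![2, 3] : Fin 2 → ℕ) j) := by fin_cases j <;> assumption
    have hj : (ProjectiveSpace.pointOfVec K p₀ hp₀).pt ∈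
        ProjectiveSpectrum.zeroLocus (MvPolynomial.homogeneousSubmodule (Fin (8 + 1)) K) {![Q, C] j} :=
      (ProjectiveSpectrum.mem_zeroLocus _ _ _).mpr
        ((Set.singleton_subset_iff.mpr (Set.mem_range_self j)).trans
          ((ProjectiveSpectrum.mem_zeroLocus _ _ _).mp hmemV))
    have h := (ProjectiveSpace.pt_pointOfVec_mem_zeroLocus_iff p₀ hp₀ hdeg
      ((mem_homogeneousSubmodule _ _).mpr hhom)).mp hj
    rwa [MvPolynomial.aeval_eq_eval] at h
  -- the fat flag through `p₀`
  obtain ⟨u, v, w, hli, hpspan, hQvan, hCfat⟩ :=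
    exists_fatFlag_of_forms hQ hC hp₀ (hFp 0) (hFp 1)
  -- the linear form `ℓ` of the line inside the plane: `ℓ(u) = ℓ(v) = 0`, `ℓ(w) = 1`
  have hlio : LinearIndepOn K id (Set.range ![u, v, w]) := hli.linearIndepOn_id
  set b := Module.Basis.extend hlio with hb
  have hbself : ∀ i, b i = (i : Fin (8 + 1) → K) := Module.Basis.extend_apply_self hlio
  have hsub : Set.range ![u, v, w] ⊆ hlio.extend (Set.subset_univ _) := hlio.subset_extend _
  set iu : ↥(hlio.extend (Set.subset_univ _)) := ⟨u, hsub ⟨0, rfl⟩⟩ with hiu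
  set iv : ↥(hlio.extend (Set.subset_univ _)) := ⟨v, hsub ⟨1, rfl⟩⟩ with hiv
  set iw : ↥(hlio.extend (Set.subset_univ _)) := ⟨w, hsub ⟨2, rfl⟩⟩ with hiw
  set ℓ : MvPolynomial (Fin (8 + 1)) K := ∑ m : Fin (8 + 1), MvPolynomial.C (b.repr (Pi.single m 1) iw) * X m with hℓ
  have hℓeval : ∀ q, MvPolynomial.eval q ℓ = b.repr q iw := fun q =>
    Literature.RingTheory.MvPolynomial.eval_coordForm b iw q
  have hℓhom : ℓ.IsHomogeneous 1 := Literature.RingTheory.MvPolynomial.isHomogeneous_coordForm b iw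
  have hinj := hli.injective
  have huw : iu ≠ iw := by
    intro h; have h' := congrArg Subtype.val h
    exact absurd (hinj (show (![u, v, w] : Fin 3 → _) 0 = ![u, v, w] 2 from h')) (by decide)
  have hvw : iv ≠ iw := by
    intro h; have h' := congrArg Subtype.val h
    exact absurd (hinj (show (![u, v, w] : Fin 3 → _) 1 = ![u, v, w] 2 from h')) (by decide)
  have hrepr : ∀ i : ↥(hlio.extend (Set.subset_univ _)), b.repr (i : Fin (8 + 1) → K) = Finsupp.single i 1 := by
    intro i
    have h := b.repr_self i
    rwa [hbself] at h
  have hℓu : MvPolynomial.eval u ℓ = 0 := by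
    rw [hℓeval]
    change b.repr (iu : Fin (8 + 1) → K) iw = 0
    rw [hrepr, Finsupp.single_apply, if_neg huw]
  have hℓv : MvPolynomial.eval v ℓ = 0 := by
    rw [hℓeval]
    change b.repr (iv : Fin (8 + 1) → K) iw = 0
    rw [hrepr, Finsupp.single_apply, if_neg hvw]
  have hℓw : MvPolynomial.eval w ℓ = 1 := by
    rw [hℓeval]
    change b.repr (iw : Fin (8 + 1) → K) iw = 1
    rw [hrepr, Finsupp.single_apply, if_pos rfl]
  have hℓcomb : ∀ c : Fin 3 → K, MvPolynomial.eval (comb u v w c) ℓ = c 2 := by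
    intro c
    rw [hℓeval]
    simp only [comb, map_add, map_smul, Finsupp.add_apply, Finsupp.smul_apply, smul_eq_mul]
    rw [← hℓeval, ← hℓeval, ← hℓeval, hℓu, hℓv, hℓw]; ring
  set lam : K := MvPolynomial.eval w C with hlam
  -- the plane forms
  set FP : Bool → MvPolynomial (Fin (8 + 1)) K := fun s => if s then C - MvPolynomial.C lam * ℓ ^ 3 else Q with hFP
  have hFPvan : ∀ s, ∀ q ∈ Submodule.span K (Set.range ![u, v, w]), MvPolynomial.eval q (FP s) = 0 := by
    intro s q hq
    obtain ⟨c, rfl⟩ := exists_comb_of_mem_span hq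
    cases s
    · simp only [hFP]; exact hQvan c
    · simp only [hFP, if_true, map_sub, map_mul, map_pow, MvPolynomial.eval_C, hℓcomb, hCfat c, hlam]
      ring
  obtain ⟨tP, M, htP, hMli, hMhom, hFM, hMvan⟩ :=
    EsnaultLevineViehweg.exists_linearForms_forall_mem_ideal_span FP hli hFPvan
  obtain rfl : tP = 8 - 2 := by omega
  -- the line forms
  have hli2 : LinearIndependent K ![u, v] := by
    have h := hli.comp (Fin.castSucc : Fin 2 → Fin 3) (Fin.castSucc_injective 2)
    have heq : (![u, v, w] : Fin 3 → Fin (8 + 1) → K) ∘ (Fin.castSucc : Fin 2 → Fin 3) = ![u, v] := by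
      funext i; fin_cases i <;> rfl
    rwa [heq] at h
  set FL : (Fin (8 - 2)) ⊕ Fin 3 → MvPolynomial (Fin (8 + 1)) K :=
    fun s => Sum.elim M ![Q, C, ℓ] s with hFL
  have hFLvan : ∀ s, ∀ q ∈ Submodule.span K (Set.range ![u, v]), MvPolynomial.eval q (FL s) = 0 := by
    intro s q hq
    obtain ⟨c, hc2, rfl⟩ := exists_comb_of_mem_span_pair (w := w) hq
    rcases s with j | j
    · exact hMvan j _ (comb_mem_span u v w c)
    · fin_cases j
      · exact hQvan c
      · change MvPolynomial.eval (comb u v w c) C = 0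
        rw [hCfat c, hc2]; ring
      · change MvPolynomial.eval (comb u v w c) ℓ = 0
        rw [hℓcomb c, hc2]
  obtain ⟨tL, Lf, htL, hLli, hLhom, hFLmem, hLvan⟩ :=
    EsnaultLevineViehweg.exists_linearForms_forall_mem_ideal_span FL hli2 hFLvan
  obtain rfl : tL = 8 - 1 := by omega
  -- the plane point of `V₊(Q)`
  have hrangeQ : Set.range iQ.left.base =
      ProjectiveSpectrum.zeroLocus (MvPolynomial.homogeneousSubmodule (Fin (8 + 1)) K) (Set.range (fun _ : Fin 1 => Q)) :=
    range_completeIntersectionι _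
  have hsubP : ProjectiveSpectrum.zeroLocus (MvPolynomial.homogeneousSubmodule (Fin (8 + 1)) K)
      (Set.range M) ⊆ Set.range iQ.left.base := by
    intro q hq
    have hqM := (ProjectiveSpectrum.mem_zeroLocus _ _ _).mp hq
    have hspan : Ideal.span (Set.range M) ≤
        (ProjectiveSpectrum.asHomogeneousIdeal (𝒜 := MvPolynomial.homogeneousSubmodule (Fin (8 + 1)) K) q).toIdeal :=
      Ideal.span_le.mpr hqM
    have hq' : (q : ↥(projectiveSpace 8 K).left) ∈
        ProjectiveSpectrum.zeroLocus (MvPolynomial.homogeneousSubmodule (Fin (8 + 1)) K)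
          (Set.range (fun _ : Fin 1 => Q)) :=
      (ProjectiveSpectrum.mem_zeroLocus _ _ _).mpr (by
        rintro _ ⟨j, rfl⟩
        exact hspan (hFM false))
    have hq'' : (q : ↥(projectiveSpace 8 K).left) ∈ Set.range iQ.left.base := by
      rw [hrangeQ]; exact hq'
    exact hq''
  obtain ⟨wpt, hwpt, himgP⟩ :=
    EsnaultLevineViehweg.exists_isLinearSubspacePoint_of_zeroLocus_subset iQ (r := 2) (by norm_num) M hMli hMhom hsubP
  -- the line point of `V₊(Q, C)`
  have hsubL : ProjectiveSpectrum.zeroLocus (MvPolynomial.homogeneousSubmodule (Fin (8 + 1)) K)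
      (Set.range Lf) ⊆ Set.range iY.left.base := by
    intro q hq
    have hqL := (ProjectiveSpectrum.mem_zeroLocus _ _ _).mp hq
    have hspan : Ideal.span (Set.range Lf) ≤
        (ProjectiveSpectrum.asHomogeneousIdeal (𝒜 := MvPolynomial.homogeneousSubmodule (Fin (8 + 1)) K) q).toIdeal :=
      Ideal.span_le.mpr hqL
    have hq' : (q : ↥(projectiveSpace 8 K).left) ∈
        ProjectiveSpectrum.zeroLocus (MvPolynomial.homogeneousSubmodule (Fin (8 + 1)) K) (Set.range ![Q, C]) :=
      (ProjectiveSpectrum.mem_zeroLocus _ _ _).mpr (by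
        rintro _ ⟨j, rfl⟩
        fin_cases j
        · exact hspan (hFLmem (Sum.inr 0))
        · exact hspan (hFLmem (Sum.inr 1)))
    have hq'' : (q : ↥(projectiveSpace 8 K).left) ∈ Set.range iY.left.base := by
      rw [hV]; exact hq'
    exact hq''
  obtain ⟨vpt, hvpt, himgL⟩ :=
    EsnaultLevineViehweg.exists_isLinearSubspacePoint_of_zeroLocus_subset iY (r := 1) (by norm_num) Lf hLli hLhom hsubL
  -- closures in `ℙ⁸`
  have hclP : closure {quadricι Q wpt} =
      ProjectiveSpectrum.zeroLocus (MvPolynomial.homogeneousSubmodule (Fin (8 + 1)) K) (Set.range M) := by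
    change closure ({iQ.left.base wpt} : Set ↥(projectiveSpace 8 K).left) = _
    rw [← image_closure_singleton_of_isClosedMap iQ.left iQ.left.isClosedMap wpt]
    exact himgP
  have hbase : iY.left vpt = iQ.left ((quadricCubicToQuadric Q C).left vpt) := by
    rw [← Scheme.Hom.comp_apply, ← Over.comp_left, quadricCubicToQuadric_ι]
  have hclL : closure {quadricι Q ((quadricCubicToQuadric Q C).left vpt)} =
      ProjectiveSpectrum.zeroLocus (MvPolynomial.homogeneousSubmodule (Fin (8 + 1)) K) (Set.range Lf) := by
    change closure ({iQ.left.base ((quadricCubicToQuadric Q C).left vpt)} : Set ↥(projectiveSpace 8 K).left) = _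
    rw [← hbase, ← image_closure_singleton_of_isClosedMap iY.left iY.left.isClosedMap vpt]
    exact himgL
  refine ⟨vpt, ⟨hvpt, wpt, ⟨hwpt, ?_⟩, ?_⟩, ?_⟩
  · -- the strong-plane alternative
    by_cases hlam0 : lam = 0
    · left
      rw [hclP]
      intro q hq
      have hqM := (ProjectiveSpectrum.mem_zeroLocus _ _ _).mp hq
      have hspan : Ideal.span (Set.range M) ≤
          (ProjectiveSpectrum.asHomogeneousIdeal (𝒜 := MvPolynomial.homogeneousSubmodule (Fin (8 + 1)) K) q).toIdeal :=
        Ideal.span_le.mpr hqM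
      refine (ProjectiveSpectrum.mem_zeroLocus _ _ _).mpr (Set.singleton_subset_iff.mpr ?_)
      have hCmem : C ∈ Ideal.span (Set.range M) := by
        have h := hFM true
        simp only [hFP, if_true, hlam0, map_zero, zero_mul, sub_zero] at h
        exact h
      exact hspan hCmem
    · right
      refine ⟨ℓ, (mem_homogeneousSubmodule _ _).mpr hℓhom, ?_, ?_⟩
      · -- `ℓ ∉ 𝔭_Π`: the ideal of the plane point is `(M)`, whose members vanish at `w`, but `ℓ(w) = 1`
        intro hmem
        have hgen : quadricι Q wpt = linearSubspacePoint M hMli hMhom (by norm_num) :=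
          eq_linearSubspacePoint_of_closure_eq M hMli hMhom (by norm_num) hclP
        have hmem' : ℓ ∈ (ProjectiveSpectrum.asHomogeneousIdeal
            (𝒜 := MvPolynomial.homogeneousSubmodule (Fin (8 + 1)) K) (linearSubspacePoint M hMli hMhom (by norm_num))).toIdeal := by
          rw [← hgen]; exact hmem
        rw [toIdeal_linearSubspacePoint] at hmem'
        have hker : Ideal.span (Set.range M) ≤ RingHom.ker (MvPolynomial.eval w) := by
          rw [Ideal.span_le]; rintro _ ⟨j, rfl⟩
          exact hMvan j w (Submodule.subset_span ⟨2, rfl⟩)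
        have h0 := hker hmem'
        rw [RingHom.mem_ker, hℓw] at h0
        exact one_ne_zero h0
      · -- `Π ∩ V₊(C) = Π ∩ V₊(ℓ)`
        rw [hclP]
        ext q
        simp only [Set.mem_inter_iff]
        constructor
        all_goals rintro ⟨hqM, hq⟩; refine ⟨hqM, ?_⟩
        all_goals
          have hqM' := (ProjectiveSpectrum.mem_zeroLocus _ _ _).mp hqM
          have hspan : Ideal.span (Set.range M) ≤
              (ProjectiveSpectrum.asHomogeneousIdeal (𝒜 := MvPolynomial.homogeneousSubmodule (Fin (8 + 1)) K) q).toIdeal :=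
            Ideal.span_le.mpr hqM'
          have hdiff : C - MvPolynomial.C lam * ℓ ^ 3 ∈
              (ProjectiveSpectrum.asHomogeneousIdeal (𝒜 := MvPolynomial.homogeneousSubmodule (Fin (8 + 1)) K) q).toIdeal := by
            have h := hFM true
            simp only [hFP, if_true] at h
            exact hspan h
          have hprime := q.isPrime
          have hq' := Set.singleton_subset_iff.mp ((ProjectiveSpectrum.mem_zeroLocus _ _ _).mp hq)
          refine (ProjectiveSpectrum.mem_zeroLocus _ _ _).mpr (Set.singleton_subset_iff.mpr ?_)
        · -- `C ∈ 𝔮 → ℓ ∈ 𝔮`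
          have h3 : MvPolynomial.C lam * ℓ ^ 3 ∈
              (ProjectiveSpectrum.asHomogeneousIdeal (𝒜 := MvPolynomial.homogeneousSubmodule (Fin (8 + 1)) K) q).toIdeal := by
            have := Ideal.sub_mem _ hq' hdiff
            simpa using this
          have h3' : ℓ ^ 3 ∈
              (ProjectiveSpectrum.asHomogeneousIdeal (𝒜 := MvPolynomial.homogeneousSubmodule (Fin (8 + 1)) K) q).toIdeal := by
            have hu : IsUnit (MvPolynomial.C lam : MvPolynomial (Fin (8 + 1)) K) :=
              (isUnit_iff_ne_zero.mpr hlam0).map MvPolynomial.C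
            exact (Ideal.unit_mul_mem_iff_mem _ hu).mp h3
          exact hprime.mem_of_pow_mem 3 h3'
        · -- `ℓ ∈ 𝔮 → C ∈ 𝔮`
          have h3 : MvPolynomial.C lam * ℓ ^ 3 ∈
              (ProjectiveSpectrum.asHomogeneousIdeal (𝒜 := MvPolynomial.homogeneousSubmodule (Fin (8 + 1)) K) q).toIdeal :=
            Ideal.mul_mem_left _ _ (Ideal.pow_mem_of_mem _ hq' 3 (by norm_num))
          have := Ideal.add_mem _ hdiff h3
          simpa using this
  · -- the line lies in the plane
    rw [hclL, hclP]
    intro q hq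
    have hqL := (ProjectiveSpectrum.mem_zeroLocus _ _ _).mp hq
    have hspan : Ideal.span (Set.range Lf) ≤
        (ProjectiveSpectrum.asHomogeneousIdeal (𝒜 := MvPolynomial.homogeneousSubmodule (Fin (8 + 1)) K) q).toIdeal :=
      Ideal.span_le.mpr hqL
    refine (ProjectiveSpectrum.mem_zeroLocus _ _ _).mpr ?_
    rintro _ ⟨j, rfl⟩
    exact hspan (hFLmem (Sum.inl j))
  · -- `x` lies on the line
    have hpt : iY.left.base x ∈
        ProjectiveSpectrum.zeroLocus (MvPolynomial.homogeneousSubmodule (Fin (8 + 1)) K) (Set.range Lf) := by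
      rw [hix]
      refine (ProjectiveSpectrum.mem_zeroLocus _ _ _).mpr ?_
      rintro _ ⟨j, rfl⟩
      have hj : (ProjectiveSpace.pointOfVec K p₀ hp₀).pt ∈
          ProjectiveSpectrum.zeroLocus (MvPolynomial.homogeneousSubmodule (Fin (8 + 1)) K) {Lf j} := by
        refine (ProjectiveSpace.pt_pointOfVec_mem_zeroLocus_iff p₀ hp₀ one_pos
          ((mem_homogeneousSubmodule _ _).mpr (hLhom j))).mpr ?_
        rw [MvPolynomial.aeval_eq_eval]
        refine hLvan j p₀ ?_
        rw [Matrix.range_cons_cons_empty]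
        exact hpspan
      exact Set.singleton_subset_iff.mp ((ProjectiveSpectrum.mem_zeroLocus _ _ _).mp hj)
    rw [← himgL] at hpt
    obtain ⟨x', hx', hxx'⟩ := hpt
    rwa [← iY.left.isClosedEmbedding.injective hxx']

end Geometry


end Literature.AlgebraicGeometry.Motives

end
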